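import Summits.ResolutionOfSingularities.ResolutionOfSingularities.Theses.PAlteration
import Summits.ResolutionOfSingularities.ResolutionOfSingularities.Theorems.PAlterationPicoverFunctionFieldNormalizationIn
import Summits.ResolutionOfSingularities.ResolutionOfSingularities.Theorems.PAlterationPicoverFunctionFieldRadicial
import Summits.ResolutionOfSingularities.ResolutionOfSingularities.Theorems.PAlterationPicoverOfNormalizationIn
import Summits.ResolutionOfSingularities.ResolutionOfSingularities.Theorems.PAlterationPicoverPTower
import Summits.ResolutionOfSingularities.ResolutionOfSingularities.Theorems.PAlterationPicoverBaseCase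
import Summits.ResolutionOfSingularities.ResolutionOfSingularities.Theorems.PAlterationPicoverTowerTransport

/-!
# Crux `Picover` (stmt-ResolutionOfSingularities-0554): the crux from its degree-`p` residue

Route `ResolutionOfSingularities/pAlteration`, line `degree-p-tower` (lead composition, sorry-free
and CONDITIONAL): **Temkin's induction** (Temkin 2013 = arXiv:0804.1554v3, Rem. 1.3.5 (ii):
"if we know how to uniformize valuations on `α_p`-torsors over regular schemes, then … proceeding
inductively") in global form. If, for the fixed prime `p` and every field `k` of characteristic
`p`, the normalization of every regular integral separated finite-type `k`-scheme `W` in every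
purely inseparable extension `L/K(W)` of degree `p` has a resolution (the RESIDUE, the line's
`stub_picoverDegP`: the global form of the hypersurface case `t^p = f`), then `Picover` holds: every
integral `X` finite, universally injective and surjective over a regular integral separated
finite-type `Y` has a resolution.

Proof (all ingredients landed as `--supports` files of the crux item): `K(X)/K(Y)` along `g` is
finite (finite `g`) and purely inseparable (`stub_functionFieldRadicial`, Stacks 01S4), of degree
`p^n` (`IsPurelyInseparable.finrank_eq_pow`); by induction on `n`, splitting off an intermediate
field of index `p` (`stub_pTower`) and transporting resolvability up the layer
(`stub_towerTransport`, which consumes the residue and the function-field identification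
`stub_functionField_normalizationIn`), starting from degree one (`stub_baseCase`), the
normalization `Y^{K(X)}` has a resolution; the finite birational comparison `Y^{K(X)} → X`
transfers it to `X` (`stub_ofNormalizationIn`). The converse `Picover → residue` is the sub-goal
`picoverDegP_of_picover`; together: `Picover ⟺ residue`.
-/

noncomputable section

set_option linter.dupNamespace false -- mandated namespace of this single-conjunct summit

open CategoryTheory AlgebraicGeometry TopologicalSpace
open Literature.AlgebraicGeometry.Resolution Literature.AlgebraicGeometry.Motives
open Summit.ResolutionOfSingularities.ResolutionOfSingularities.Theorems.Picover

namespace Summit.ResolutionOfSingularities.ResolutionOfSingularities.Theorems.Picover.OfDegP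

/-- **Induction along the `p`-tower.** Under the residue at `(p, k)`, every finite purely
inseparable extension `L` of `K(Y)` of degree `p ^ n`, `Y` regular integral separated of finite
type over `k`, has `HasResolution (Y^L)`: degree one by `stub_baseCase`; the step splits off an
intermediate field `M` of index `p` (`stub_pTower`, tower law) and applies `stub_towerTransport`.
[cite: Temkin2013, Rem. 1.3.5 (ii)] -/
theorem hasResolution_normalizationIn_of_finrank_eq_pow {p : ℕ} [Fact p.Prime] {k : Type}
    [Field k] [CharP k p]
    (hDegP : ∀ (W : Scheme.{0}) [IsIntegral W] (f : W ⟶ Spec (.of k)) (L : Type) [Field L]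
      [Algebra W.functionField L], IsSeparated f → LocallyOfFiniteType f → QuasiCompact f →
        Scheme.IsRegular W → IsPurelyInseparable W.functionField L →
          Module.finrank W.functionField L = p → Scheme.HasResolution (normalizationIn W L))
    (Y : Scheme.{0}) [IsIntegral Y] (f : Y ⟶ Spec (.of k)) [IsSeparated f]
    [LocallyOfFiniteType f] [QuasiCompact f] (hYreg : Scheme.IsRegular Y) :
    ∀ (n : ℕ) (L : Type) [Field L] [Algebra Y.functionField L]
      [FiniteDimensional Y.functionField L] [IsPurelyInseparable Y.functionField L],
      Module.finrank Y.functionField L = p ^ n → Scheme.HasResolution (normalizationIn Y L) := by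
  intro n
  induction n with
  | zero =>
    intro L _ _ _ _ hdeg
    exact BaseCase.stub_baseCase Y L
      (FunctionFieldNormalizationIn.stub_functionField_normalizationIn Y L) hYreg
      (by simpa using hdeg)
  | succ n ih =>
    intro L _ _ _ _ hdeg
    haveI : CharP Y.functionField p := TowerTransport.charP_functionField Y f
    have hp : (p : ℕ).Prime := Fact.out
    have hne : Module.finrank Y.functionField L ≠ 1 := by
      rw [hdeg]
      exact (Nat.one_lt_pow (Nat.succ_ne_zero n) hp.one_lt).ne'
    obtain ⟨M, hM⟩ := PTower.stub_pTower p Y.functionField L hne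
    have hMdeg : Module.finrank Y.functionField M = p ^ n := by
      have htower := Module.finrank_mul_finrank Y.functionField M L
      rw [hM, hdeg, pow_succ] at htower
      exact Nat.eq_of_mul_eq_mul_right hp.pos htower
    have hMres : Scheme.HasResolution (normalizationIn Y M) := ih M hMdeg
    exact TowerTransport.stub_towerTransport p k
      FunctionFieldNormalizationIn.stub_functionField_normalizationIn hDegP Y f L M inferInstance
      hM hMres

/-- **`Picover` from its degree-`p` residue** (registered sub-goal `picover_of_picoverDegP`,
statement verbatim: the residue `stub_picoverDegP` of the line `degree-p-tower` implies the crux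
`Picover` BY NAME). For `g : X → Y` as in the crux, `g` is dominant, `K(X)/K(Y)` is finite purely
inseparable (`stub_functionFieldRadicial`) of degree `p ^ n`; the tower induction resolves
`Y^{K(X)}`, and `stub_ofNormalizationIn` transfers the resolution to `X`.
[cite: Temkin2013, Rem. 1.3.5 (ii)-(iii)] -/
theorem picover_of_picoverDegP : (∀ (p : ℕ), p.Prime → ∀ (k : Type) [Field k] [CharP k p] (W : Scheme.{0}) [IsIntegral W] (f : W ⟶ Spec (.of k)) (L : Type) [Field L] [Algebra W.functionField L], IsSeparated f → LocallyOfFiniteType f → QuasiCompact f → Scheme.IsRegular W → IsPurelyInseparable W.functionField L → Module.finrank W.functionField L = p → Scheme.HasResolution (normalizationIn W L)) → Summit.ResolutionOfSingularities.ResolutionOfSingularities.Theses.PAlteration.Picover := by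
  intro hDegP p hp k _ _ Y X f g hsep hlft hqc hY hYreg hX hfin hui hsurj
  haveI : Fact p.Prime := ⟨hp⟩
  haveI : IsDominant g := ⟨hsurj.denseRange⟩
  haveI : CharP Y.functionField p := TowerTransport.charP_functionField Y f
  haveI : ExpChar Y.functionField p := ExpChar.prime hp
  haveI : IsPurelyInseparable Y.functionField (FunctionFieldOver g) :=
    FunctionFieldRadicial.stub_functionFieldRadicial X Y g
  obtain ⟨n, hn⟩ := IsPurelyInseparable.finrank_eq_pow Y.functionField (FunctionFieldOver g) p
  have hN : Scheme.HasResolution (normalizationIn Y (FunctionFieldOver g)) :=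
    hasResolution_normalizationIn_of_finrank_eq_pow (hDegP p hp k) Y f hYreg n
      (FunctionFieldOver g) hn
  exact OfNormalizationIn.stub_ofNormalizationIn k X Y f g
    (FunctionFieldNormalizationIn.stub_functionField_normalizationIn Y (FunctionFieldOver g)) hN

end Summit.ResolutionOfSingularities.ResolutionOfSingularities.Theorems.Picover.OfDegP

end
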